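import Mathlib
import Literature.Analysis.FluidPDE.TypeIICoreWitness
import Summits.NavierStokesRegularity.NavierStokesRegularity.Theorems.TypeIIInviscidRelaxationMonopoleCoreExclusionAnchorObstructionFamily
import HarnessLib

/-!
# Crux `MonopoleCoreExclusion` (stmt-1965): anchoring at the singular point is not kinematic for the axisymmetric
# class either (a wandering axisymmetric core with its spoiler shell)

`--supports stmt-NavierStokesRegularity-1965` (helper file, negative side; theorems only, no definitions, no `sorry`).
Axisymmetric twin of `CoreExclusionAnchorObstruction.exists_columnarWitnesses_unanchored` (p832578) and sequel to
`MonopoleAnchorObstruction.exists_axisymWitnesses_never_late` (p832545), whose family was centred AT the singular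
point.  Here the whole core-plus-shell configuration of `mul_sub_one_lt_of_shellSpoiler` (axisymmetric cone core of
radius `(1-t)²/24`, speed `(1-t)⁻³`, spoiler shell `(1-t)/6 ≤ ‖x - c‖ ≤ (1-t)/3`) is centred at the wandering point
`c(t) = (1-t)·e_y → 0`.  Then (`exists_axisymWitnesses_unanchored`): (i) AXISYMMETRIC witnesses at every level
frequently before `T = 1` (`hw` of the crux verbatim); (ii) the origin is singular in the stub's sense and (ii') every
other point is regular; (iii) for `K ≥ 25`, `0 < t < 1`, EVERY axisymmetric datum satisfying the speed-bound,
near-maximum and closeness clauses has `K·L ≤ 1 - t`, is not late, and is NOT anchored at the singular point: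
`dist 0 x₀ > K·L/4`.  (The obstruction theorem is applied to the recentred slice and datum — the witness clauses are
translation-covariant.)  Nothing about Navier–Stokes is claimed; `u` is not a solution.
-/

noncomputable section

open Set Metric Filter Topology
open Literature.Analysis Literature.Analysis.FluidPDE

namespace Summit.NavierStokesRegularity.NavierStokesRegularity.Theorems

-- the problem directory repeats the summit name (`NavierStokesRegularity/NavierStokesRegularity`)
set_option linter.dupNamespace false

namespace MonopoleAnchorObstruction

/-- `‖e_z‖ = 1` (file-local copy). [folklore] -/
private theorem norm_eZ_w : ‖(eZ : EuclideanSpace ℝ (Fin 3))‖ = 1 := by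
  simp [eZ]

/-- **A wandering axisymmetric core with spoiler shell: witnesses at every level, a unique singular point, and no
axisymmetric witness anchored at it** (see the module docstring). [folklore] -/
theorem exists_axisymWitnesses_unanchored :
    ∃ u : ℝ → EuclideanSpace ℝ (Fin 3) → EuclideanSpace ℝ (Fin 3),
      (∀ K : ℝ, 0 < K → ∀ t₀ < (1 : ℝ), ∃ t, t₀ < t ∧ t < 1 ∧ TypeIICoreWitness IsAxisymmetric 1 K u t) ∧
      (¬ ∃ ρ M : ℝ, 0 < ρ ∧ ∀ s ∈ Ioo (1 - ρ ^ 2) 1, ∀ x ∈ ball (0 : EuclideanSpace ℝ (Fin 3)) ρ,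
        ‖u s x‖ ≤ M) ∧
      (∀ xr : EuclideanSpace ℝ (Fin 3), xr ≠ 0 → ∃ ρ M : ℝ, 0 < ρ ∧ ∀ s ∈ Ioo (1 - ρ ^ 2) 1,
        ∀ x ∈ ball xr ρ, ‖u s x‖ ≤ M) ∧
      (∀ (K t : ℝ), 25 ≤ K → 0 < t → t < 1 →
        ∀ (x₀ : EuclideanSpace ℝ (Fin 3)) (L V : ℝ)
          (Q : EuclideanSpace ℝ (Fin 3) ≃ₗᵢ[ℝ] EuclideanSpace ℝ (Fin 3))
          (W : EuclideanSpace ℝ (Fin 3) → EuclideanSpace ℝ (Fin 3)),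
          0 < L → 0 < V → IsAxisymmetric W → (∀ x, ‖u t x‖ ≤ V) →
          (∃ x₁, dist x₁ x₀ ≤ L ∧ V ≤ 2 * ‖u t x₁‖) →
          (∀ y : EuclideanSpace ℝ (Fin 3), ‖y‖ ≤ K →
            ‖V⁻¹ • Q.symm (u t (x₀ + L • Q y)) - W y‖ ≤ K⁻¹) →
          K * L ≤ 1 - t ∧ K * L < (1 - t) * V ∧ K * L / 4 < dist 0 x₀) := by
  -- the centred slice `F t`, the wandering centre `c t`, the family `u t x = F t (x - c t)`
  set G : EuclideanSpace ℝ (Fin 3) → EuclideanSpace ℝ (Fin 3) :=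
    fun y => max 0 (1 - ‖y‖) • (eZ : EuclideanSpace ℝ (Fin 3)) with hG
  set F : ℝ → EuclideanSpace ℝ (Fin 3) → EuclideanSpace ℝ (Fin 3) :=
    fun t z => if ‖z‖ ≤ (1 - t) ^ 2 / 24
      then ((1 - t)⁻¹ ^ 3 * max 0 (1 - ‖z‖ / ((1 - t) ^ 2 / 24))) • (eZ : EuclideanSpace ℝ (Fin 3))
      else if (1 - t) / 6 ≤ ‖z‖ ∧ ‖z‖ ≤ 2 * ((1 - t) / 6)
        then ((1 - t)⁻¹ ^ 3 / 3) • EuclideanSpace.single 0 1 else 0 with hF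
  set c : ℝ → EuclideanSpace ℝ (Fin 3) := fun t => (1 - t) • EuclideanSpace.single 1 1 with hc
  set u : ℝ → EuclideanSpace ℝ (Fin 3) → EuclideanSpace ℝ (Fin 3) := fun t x => F t (x - c t) with hu
  have hnc : ∀ t < (1 : ℝ), ‖c t‖ = 1 - t := by
    intro t ht
    simp only [hc, norm_smul, Real.norm_of_nonneg (sub_pos.2 ht).le]
    simp
  -- the four region clauses of the centred slice, `0 < t < 1`
  have hcl : ∀ t : ℝ, 0 < t → t < 1 →
      (∀ z : EuclideanSpace ℝ (Fin 3), ‖z‖ ≤ (1 - t) ^ 2 / 24 →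
        F t z = ((1 - t)⁻¹ ^ 3 * max 0 (1 - ‖z‖ / ((1 - t) ^ 2 / 24))) • (eZ : EuclideanSpace ℝ (Fin 3))) ∧
      (∀ z : EuclideanSpace ℝ (Fin 3), (1 - t) ^ 2 / 24 < ‖z‖ → ‖z‖ < (1 - t) / 6 → F t z = 0) ∧
      (∀ z : EuclideanSpace ℝ (Fin 3), (1 - t) / 6 ≤ ‖z‖ → ‖z‖ ≤ 2 * ((1 - t) / 6) →
        F t z = ((1 - t)⁻¹ ^ 3 / 3) • EuclideanSpace.single 0 1) ∧
      (∀ z : EuclideanSpace ℝ (Fin 3), 2 * ((1 - t) / 6) < ‖z‖ → F t z = 0) := by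
    intro t ht0 ht1
    have hs : 0 < 1 - t := sub_pos.2 ht1
    have haD : (1 - t) ^ 2 / 24 < (1 - t) / 6 := by nlinarith
    refine ⟨fun z hz => by simp only [hF, if_pos hz], fun z hz1 hz2 => ?_, fun z hz1 hz2 => ?_, fun z hz => ?_⟩
    · have h1 : ¬ ‖z‖ ≤ (1 - t) ^ 2 / 24 := not_le.2 hz1
      have h2 : ¬ ((1 - t) / 6 ≤ ‖z‖ ∧ ‖z‖ ≤ 2 * ((1 - t) / 6)) := fun h => absurd h.1 (not_le.2 hz2)
      simp only [hF, if_neg h1, if_neg h2]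
    · have h1 : ¬ ‖z‖ ≤ (1 - t) ^ 2 / 24 := not_le.2 (haD.trans_le hz1)
      have h2 : (1 - t) / 6 ≤ ‖z‖ ∧ ‖z‖ ≤ 2 * ((1 - t) / 6) := ⟨hz1, hz2⟩
      simp only [hF, if_neg h1, if_pos h2]
    · have h1 : ¬ ‖z‖ ≤ (1 - t) ^ 2 / 24 := not_le.2 (by linarith)
      have h2 : ¬ ((1 - t) / 6 ≤ ‖z‖ ∧ ‖z‖ ≤ 2 * ((1 - t) / 6)) := fun h => absurd h.2 (not_le.2 hz)
      simp only [hF, if_neg h1, if_neg h2]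
  -- sizes of the centred slice and of `u`, `0 < t < 1`
  have hsizes : ∀ t : ℝ, 0 < t → t < 1 →
      (∀ z, ‖F t z‖ ≤ (1 - t)⁻¹ ^ 3) ∧ (∀ z, (1 - t) ^ 2 / 24 < ‖z‖ → 3 * ‖F t z‖ ≤ (1 - t)⁻¹ ^ 3) ∧
        F t 0 = ((1 - t)⁻¹ ^ 3) • (eZ : EuclideanSpace ℝ (Fin 3)) := by
    intro t ht0 ht1
    have hs : 0 < 1 - t := sub_pos.2 ht1
    obtain ⟨f1, f2, f3, f4⟩ := hcl t ht0 ht1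
    exact shellSpoiler_sizes (by positivity) (by positivity) f1 f2 f3 f4
  have huF : ∀ t x, u t x = F t (x - c t) := fun t x => rfl
  have huc : ∀ t, 0 < t → t < 1 → ‖u t (c t)‖ = (1 - t)⁻¹ ^ 3 := by
    intro t ht0 ht1
    obtain ⟨-, -, h0⟩ := hsizes t ht0 ht1
    rw [huF, sub_self, h0, norm_smul, norm_eZ_w, mul_one, Real.norm_of_nonneg (by positivity)]
  have hbound : ∀ t, 0 < t → t < 1 → ∀ x, ‖u t x‖ ≤ (1 - t)⁻¹ ^ 3 := by
    intro t ht0 ht1 x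
    obtain ⟨h, -, -⟩ := hsizes t ht0 ht1
    rw [huF]; exact h _
  have hsupp : ∀ t, 0 < t → t < 1 → ∀ x, u t x ≠ 0 → ‖x - c t‖ ≤ (1 - t) / 3 := by
    intro t ht0 ht1 x hx
    obtain ⟨-, -, -, f4⟩ := hcl t ht0 ht1
    by_contra h
    exact hx (by rw [huF]; exact f4 _ (by linarith))
  -- the obstruction, recentred: `L (K-1) < (1-t)/3` and `(1-t)⁻³ ≤ V`
  have hobs : ∀ (K t : ℝ), 25 ≤ K → 0 < t → t < 1 →
      ∀ (x₀ : EuclideanSpace ℝ (Fin 3)) (L V : ℝ)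
        (Q : EuclideanSpace ℝ (Fin 3) ≃ₗᵢ[ℝ] EuclideanSpace ℝ (Fin 3))
        (W : EuclideanSpace ℝ (Fin 3) → EuclideanSpace ℝ (Fin 3)),
        0 < L → 0 < V → IsAxisymmetric W → (∀ x, ‖u t x‖ ≤ V) →
        (∃ x₁, dist x₁ x₀ ≤ L ∧ V ≤ 2 * ‖u t x₁‖) →
        (∀ y : EuclideanSpace ℝ (Fin 3), ‖y‖ ≤ K →
          ‖V⁻¹ • Q.symm (u t (x₀ + L • Q y)) - W y‖ ≤ K⁻¹) →
        L * (K - 1) < (1 - t) / 3 ∧ (1 - t)⁻¹ ^ 3 ≤ V := by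
    intro K t hK ht0 ht1 x₀ L V Q W hL hV hW hbd hnear hclose
    have hs : 0 < 1 - t := sub_pos.2 ht1
    obtain ⟨f1, f2, f3, f4⟩ := hcl t ht0 ht1
    have hDa : 4 * ((1 - t) ^ 2 / 24) ≤ (1 - t) / 6 := by nlinarith
    -- recentred datum
    have hbd' : ∀ z, ‖F t z‖ ≤ V := fun z => by
      have h := hbd (z + c t); rwa [huF, add_sub_cancel_right] at h
    have hnear' : ∃ x₁, dist x₁ (x₀ - c t) ≤ L ∧ V ≤ 2 * ‖F t x₁‖ := by
      obtain ⟨x₁, hx₁, hVx₁⟩ := hnear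
      refine ⟨x₁ - c t, by rwa [dist_sub_right], by rwa [huF] at hVx₁⟩
    have hclose' : ∀ y : EuclideanSpace ℝ (Fin 3), ‖y‖ ≤ K →
        ‖V⁻¹ • Q.symm (F t ((x₀ - c t) + L • Q y)) - W y‖ ≤ K⁻¹ := by
      intro y hy
      have h := hclose y hy
      rwa [huF, add_sub_right_comm] at h
    have h := mul_sub_one_lt_of_shellSpoiler (by positivity) (by positivity) hDa f1 f2 f3 f4 hK hL hV hW hbd'
      hnear' hclose'
    refine ⟨by linarith, ?_⟩
    rw [← huc t ht0 ht1]
    exact hbd (c t)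
  refine ⟨u, ?_, ?_, ?_, ?_⟩
  · -- (i) axisymmetric witnesses at every level frequently before `1`, centred at `c t`
    intro K hK t₀ ht₀
    set t : ℝ := (max (max t₀ 0) (1 - (24 * K)⁻¹) + 1) / 2 with ht
    have hK24 : 0 < (24 * K)⁻¹ := by positivity
    have hmax_lt : max (max t₀ 0) (1 - (24 * K)⁻¹) < 1 := max_lt (max_lt ht₀ one_pos) (by linarith)
    have ht₀t : t₀ < t := by
      have := (le_max_left t₀ 0).trans (le_max_left (max t₀ 0) (1 - (24 * K)⁻¹)); rw [ht]; linarith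
    have ht0 : 0 < t := by
      have := (le_max_right t₀ 0).trans (le_max_left (max t₀ 0) (1 - (24 * K)⁻¹)); rw [ht]; linarith
    have ht1 : t < 1 := by rw [ht]; linarith
    have hs : 0 < 1 - t := sub_pos.2 ht1
    have hsK : (1 - t) ≤ (24 * K)⁻¹ := by
      have := le_max_right (max t₀ 0) (1 - (24 * K)⁻¹); rw [ht]; linarith
    have hsK' : (1 - t) * K ≤ 24⁻¹ := by
      calc (1 - t) * K ≤ (24 * K)⁻¹ * K := mul_le_mul_of_nonneg_right hsK hK.le
        _ = 24⁻¹ := by field_simp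
    obtain ⟨f1, f2, -, -⟩ := hcl t ht0 ht1
    have hG0 : G 0 = eZ := by
      simp only [hG, norm_zero, sub_zero, max_eq_right zero_le_one, one_smul]
    have hG1 : G (EuclideanSpace.single 0 1) = 0 := by
      simp [hG]
    refine ⟨t, ht₀t, ht1, c t, (1 - t) ^ 2 / 24, (1 - t)⁻¹ ^ 3, LinearIsometryEquiv.refl ℝ _, G,
      by positivity, by positivity, isAxisymmetric_radialCone, hbound t ht0 ht1, ?_, ?_, ?_, ?_⟩
    · refine ⟨c t, by rw [dist_self]; positivity, ?_⟩
      rw [huc t ht0 ht1]; linarith [pow_pos (inv_pos.2 hs) 3]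
    · refine ⟨0, EuclideanSpace.single 0 1, by simp, by simp, ?_⟩
      rw [hG0, hG1, sub_zero, norm_eZ_w]
      norm_num
    · have h1 : (1 - t) ^ 2 / 24 * (1 - t)⁻¹ ^ 3 = (24 * (1 - t))⁻¹ := by field_simp
      rw [mul_one, h1, le_inv_comm₀ hK (by positivity)]
      calc 24 * (1 - t) = 24 * ((1 - t) * K) * K⁻¹ := by field_simp
        _ ≤ 24 * 24⁻¹ * K⁻¹ := by
            have := mul_le_mul_of_nonneg_left hsK' (by norm_num : (0:ℝ) ≤ 24)
            exact mul_le_mul_of_nonneg_right this (inv_nonneg.2 hK.le)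
        _ = K⁻¹ := by norm_num
    · intro y hy
      have hrefl : ∀ z : EuclideanSpace ℝ (Fin 3),
          (LinearIsometryEquiv.refl ℝ (EuclideanSpace ℝ (Fin 3))).symm z = z := fun z => rfl
      have hphys : u t (c t + ((1 - t) ^ 2 / 24) • (LinearIsometryEquiv.refl ℝ _ y)) =
          F t (((1 - t) ^ 2 / 24) • y) := by
        rw [huF]
        simp only [LinearIsometryEquiv.coe_refl, id_eq, add_sub_cancel_left]
      have hnx : ‖((1 - t) ^ 2 / 24) • y‖ = (1 - t) ^ 2 / 24 * ‖y‖ := by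
        rw [norm_smul, Real.norm_of_nonneg (by positivity)]
      rw [hphys, hrefl]
      by_cases hy1 : ‖y‖ ≤ 1
      · have hx : ‖((1 - t) ^ 2 / 24) • y‖ ≤ (1 - t) ^ 2 / 24 := by
          rw [hnx]; exact mul_le_of_le_one_right (by positivity) hy1
        rw [f1 _ hx, smul_smul, ← mul_assoc, inv_mul_cancel₀ (by positivity : (1 - t)⁻¹ ^ 3 ≠ 0), one_mul,
          hnx, mul_div_cancel_left₀ _ (by positivity : (1 - t) ^ 2 / 24 ≠ 0)]
        change ‖max 0 (1 - ‖y‖) • (eZ : EuclideanSpace ℝ (Fin 3)) - G y‖ ≤ K⁻¹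
        rw [sub_self, norm_zero]; positivity
      · push Not at hy1
        have hx1 : (1 - t) ^ 2 / 24 < ‖((1 - t) ^ 2 / 24) • y‖ := by
          rw [hnx]; exact lt_mul_of_one_lt_right (by positivity) hy1
        have hx2 : ‖((1 - t) ^ 2 / 24) • y‖ < (1 - t) / 6 := by
          rw [hnx]
          calc (1 - t) ^ 2 / 24 * ‖y‖ ≤ (1 - t) ^ 2 / 24 * K := mul_le_mul_of_nonneg_left hy (by positivity)
            _ = (1 - t) * ((1 - t) * K) / 24 := by ring
            _ ≤ (1 - t) * 24⁻¹ / 24 := by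
                have := mul_le_mul_of_nonneg_left hsK' hs.le
                linarith
            _ < (1 - t) / 6 := by nlinarith
        rw [f2 _ hx1 hx2, smul_zero, zero_sub, norm_neg]
        change ‖max 0 (1 - ‖y‖) • (eZ : EuclideanSpace ℝ (Fin 3))‖ ≤ K⁻¹
        rw [max_eq_left (by linarith), zero_smul, norm_zero]; positivity
  · -- (ii) the origin is singular: the centre `c(t) → 0` carries speed `(1-t)⁻³ → ∞`
    rintro ⟨ρ, M, hρ, hbd⟩
    set σ : ℝ := min (min (ρ ^ 2 / 2) (ρ / 2)) (|M| + 2)⁻¹ with hσ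
    have hM2 : 0 < |M| + 2 := by positivity
    have hσ0 : 0 < σ := lt_min (lt_min (by positivity) (by positivity)) (inv_pos.2 hM2)
    have hσ1 : σ ≤ ρ ^ 2 / 2 := (min_le_left _ _).trans (min_le_left _ _)
    have hσ2 : σ ≤ ρ / 2 := (min_le_left _ _).trans (min_le_right _ _)
    have hσ3 : σ ≤ (|M| + 2)⁻¹ := min_le_right _ _
    have hσle1 : σ < 1 := hσ3.trans_lt (inv_lt_one_of_one_lt₀ (by linarith [abs_nonneg M]))
    have hmem : 1 - σ ∈ Ioo (1 - ρ ^ 2) 1 := ⟨by linarith, by linarith⟩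
    have hcmem : c (1 - σ) ∈ ball (0 : EuclideanSpace ℝ (Fin 3)) ρ := by
      rw [mem_ball, dist_zero_right, hnc (1 - σ) (by linarith), sub_sub_cancel]
      linarith
    have h := hbd (1 - σ) hmem (c (1 - σ)) hcmem
    rw [huc (1 - σ) (by linarith) (by linarith), sub_sub_cancel] at h
    have h4 : |M| + 2 ≤ σ⁻¹ := by rw [le_inv_comm₀ hM2 hσ0]; exact hσ3
    have h5 : σ⁻¹ ≤ σ⁻¹ ^ 3 := by
      have h6 : (1 : ℝ) ≤ σ⁻¹ := one_le_inv_iff₀.2 ⟨hσ0, hσle1.le⟩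
      calc σ⁻¹ = σ⁻¹ ^ 1 := (pow_one _).symm
        _ ≤ σ⁻¹ ^ 3 := pow_le_pow_right₀ h6 (by norm_num)
    linarith [le_abs_self M]
  · -- (ii') every other point is regular
    intro xr hxr
    have hxr0 : 0 < ‖xr‖ := norm_pos_iff.2 hxr
    refine ⟨min (‖xr‖ / 4) 1, (‖xr‖ / 2)⁻¹ ^ 3, lt_min (by positivity) one_pos, fun s' hs' x hx => ?_⟩
    have hs'1 : s' < 1 := hs'.2
    have hmin1 : min (‖xr‖ / 4) 1 ≤ 1 := min_le_right _ _
    have hmin2 : min (‖xr‖ / 4) 1 ≤ ‖xr‖ / 4 := min_le_left _ _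
    have hs'0 : 0 < s' := by
      have h1 : (min (‖xr‖ / 4) 1) ^ 2 ≤ 1 := by
        have := pow_le_pow_left₀ (lt_min (by positivity) one_pos).le hmin1 2
        rwa [one_pow] at this
      linarith [hs'.1]
    set σ : ℝ := 1 - s' with hσ
    have hσ0 : 0 < σ := sub_pos.2 hs'1
    by_cases hσx : σ < ‖xr‖ / 2
    · -- the configuration is far from `x`: `u s' x = 0`
      have hfar : (1 - s') / 3 < ‖x - c s'‖ := by
        rw [mem_ball] at hx
        have h3 : ‖xr‖ ≤ dist xr (c s') + ‖c s'‖ := by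
          rw [dist_eq_norm]
          calc ‖xr‖ = ‖(xr - c s') + c s'‖ := by rw [sub_add_cancel]
            _ ≤ ‖xr - c s'‖ + ‖c s'‖ := norm_add_le _ _
        have h2 : dist xr (c s') ≤ dist xr x + dist x (c s') := dist_triangle _ _ _
        rw [dist_comm xr x] at h2
        rw [hnc s' hs'1] at h3
        rw [← dist_eq_norm, ← hσ] at *
        linarith
      have h0 : u s' x = 0 := by
        by_contra h
        exact absurd (hsupp s' hs'0 hs'1 x h) (not_le.2 hfar)
      rw [h0, norm_zero]
      positivity
    · push Not at hσx
      refine (hbound s' hs'0 hs'1 x).trans ?_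
      rw [← hσ]
      exact pow_le_pow_left₀ (by positivity) (inv_anti₀ (by positivity) hσx) 3
  · -- (iii) no floor, never late, never anchored at the singular point
    intro K t hK ht0 ht1 x₀ L V Q W hL hV hW hbd hnear hclose
    have hs : 0 < 1 - t := sub_pos.2 ht1
    obtain ⟨hLK, hV'⟩ := hobs K t hK ht0 ht1 x₀ L V Q W hL hV hW hbd hnear hclose
    have hL72 : L * 24 ≤ L * (K - 1) := mul_le_mul_of_nonneg_left (by linarith) hL.le
    have hKL : K * L < (1 - t) / 2 := by nlinarith
    have h1 : (1 : ℝ) ≤ (1 - t)⁻¹ ^ 3 := one_le_pow₀ (one_le_inv_iff₀.2 ⟨hs, by linarith⟩)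
    have h2 : (1 - t) * 1 ≤ (1 - t) * V := mul_le_mul_of_nonneg_left (h1.trans hV') hs.le
    refine ⟨by linarith, by linarith, ?_⟩
    obtain ⟨x₁, hx₁, hVx₁⟩ := hnear
    have hfx₁ : u t x₁ ≠ 0 := by
      intro h
      rw [h, norm_zero, mul_zero] at hVx₁
      exact absurd hVx₁ (not_le.2 hV)
    have hx₁c : dist x₁ (c t) ≤ (1 - t) / 3 := by rw [dist_eq_norm]; exact hsupp t ht0 ht1 x₁ hfx₁
    have hL24 : L ≤ (1 - t) / 72 := by nlinarith
    have htri : 1 - t ≤ dist 0 x₀ + L + (1 - t) / 3 := by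
      have h3 : dist (0 : EuclideanSpace ℝ (Fin 3)) (c t) = 1 - t := by
        rw [dist_comm, dist_zero_right, hnc t ht1]
      have h4 := dist_triangle (0 : EuclideanSpace ℝ (Fin 3)) x₀ (c t)
      have h5 := dist_triangle x₀ x₁ (c t)
      rw [dist_comm x₀ x₁] at h5
      linarith
    linarith

end MonopoleAnchorObstruction

end Summit.NavierStokesRegularity.NavierStokesRegularity.Theorems

end
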